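import Literature.AlgebraicGeometry.Resolution.HironakaDirectrix
import Mathlib.LinearAlgebra.Matrix.ToLin
import HarnessLib

/-!
# `τ` is invariant under linear changes of coordinates (CoP1, proof of Prop. 4.2)

Topic: `Literature/AlgebraicGeometry/Resolution`. The directrix and `τ(x)` of [CoP1] =
Cossart–Piltant, J. Algebra 320 (2008), proof of Prop. 4.2 (p. 7) are defined in
`gr_𝔪(R) = k(x)[Y_1, Y_2, Y_3]` "where `(y_1, y_2, y_3)` is a r.s.p. of `R`"; another regular
system of parameters changes the `Y_i` by an invertible linear substitution. PROVED here, for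
the coordinate model of `HironakaDirectrix.lean`: under the substitution `Y ↦ AY` by an
invertible matrix `A`, the invariance space transforms by `w ↦ A⁻¹w` and **`τ` does not change**
— so `τ(x)` does not depend on the regular system of parameters (given the linear change of
initial forms, `RegularLocalRingsNormal.lean`).

* `linSubst k A : k[Y] → k[Y]`, `Y_i ↦ Σ_j A_{ij} Y_j`, and `linSubstT k A` (the same on
  `k[Y, T]`, `T ↦ T`); `linSubstT_comp_rename`, `linSubst_mul`, `linSubstT_mul` (functoriality:
  `σ_{AB} = σ_B ∘ σ_A`);
* `translate_comp_linSubstT` — **`τ_w ∘ σ_A = σ_A ∘ τ_{Aw}`**;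
* `mem_invarianceSpace_image_linSubst_iff` — for `A` invertible, `w ∈ 𝕎(σ_A S) ↔ Aw ∈ 𝕎(S)`;
  `finrank_invarianceSpace_image_linSubst`, `hironakaTau_image_linSubst` — **`τ(σ_A S) = τ(S)`**.

## Sources

* V. Cossart, O. Piltant, J. Algebra 320 (2008), proof of Prop. 4.2, p. 7. [CossartPiltant2008]
-/

noncomputable section

open MvPolynomial

namespace Literature.AlgebraicGeometry.Resolution

universe u

section LinSubst

variable (k : Type u) [CommRing k] {d : ℕ}

/-- **The linear substitution `Y_i ↦ Σ_j A_{ij} Y_j`** on `k[Y_1, …, Y_d]`. [folklore] -/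
def linSubst (A : Matrix (Fin d) (Fin d) k) : MvPolynomial (Fin d) k →ₐ[k] MvPolynomial (Fin d) k :=
  aeval fun i => ∑ j, C (A i j) * X j

/-- The same substitution on `k[Y, T]`, fixing `T`. [folklore] -/
def linSubstT (A : Matrix (Fin d) (Fin d) k) :
    MvPolynomial (Option (Fin d)) k →ₐ[k] MvPolynomial (Option (Fin d)) k :=
  aeval fun o : Option (Fin d) => o.elim (X none) fun i => ∑ j, C (A i j) * X (some j)

/-- `σ_A(Y_i) = Σ_j A_{ij} Y_j`. [folklore] -/
@[simp] theorem linSubst_X (A : Matrix (Fin d) (Fin d) k) (i : Fin d) :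
    linSubst k A (X i) = ∑ j, C (A i j) * X j := by
  simp [linSubst]

/-- `σ_A(T) = T` on `k[Y, T]`. [folklore] -/
@[simp] theorem linSubstT_X_none (A : Matrix (Fin d) (Fin d) k) :
    linSubstT k A (X none) = X none := by
  simp [linSubstT]

/-- `σ_A(Y_i) = Σ_j A_{ij} Y_j` on `k[Y, T]`. [folklore] -/
@[simp] theorem linSubstT_X_some (A : Matrix (Fin d) (Fin d) k) (i : Fin d) :
    linSubstT k A (X (some i)) = ∑ j, C (A i j) * X (some j) := by
  simp [linSubstT]

/-- `σ_A` on `k[Y, T]` extends `σ_A` on `k[Y]`. [folklore] -/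
theorem linSubstT_comp_rename (A : Matrix (Fin d) (Fin d) k) :
    (linSubstT k A).comp (rename some) = (rename some).comp (linSubst k A) := by
  refine MvPolynomial.algHom_ext fun i => ?_
  rw [AlgHom.comp_apply, AlgHom.comp_apply, rename_X, linSubstT_X_some, linSubst_X, map_sum]
  exact Finset.sum_congr rfl fun j _ => by rw [map_mul, rename_C, rename_X]

/-- `σ_1 = id`. [folklore] -/
theorem linSubst_one : linSubst k (1 : Matrix (Fin d) (Fin d) k) = AlgHom.id k _ := by
  refine MvPolynomial.algHom_ext fun i => ?_
  rw [linSubst_X, AlgHom.id_apply, Finset.sum_eq_single i]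
  · rw [Matrix.one_apply_eq, C_1, one_mul]
  · intro j _ hji
    rw [Matrix.one_apply_ne (Ne.symm hji), C_0, zero_mul]
  · exact fun h => (h (Finset.mem_univ i)).elim

/-- `σ_1 = id` on `k[Y, T]`. [folklore] -/
theorem linSubstT_one : linSubstT k (1 : Matrix (Fin d) (Fin d) k) = AlgHom.id k _ := by
  refine MvPolynomial.algHom_ext fun o => ?_
  cases o with
  | none => simp
  | some i =>
    rw [linSubstT_X_some, AlgHom.id_apply, Finset.sum_eq_single i]
    · rw [Matrix.one_apply_eq, C_1, one_mul]
    · intro j _ hji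
      rw [Matrix.one_apply_ne (Ne.symm hji), C_0, zero_mul]
    · exact fun h => (h (Finset.mem_univ i)).elim

/-- **Functoriality (contravariant): `σ_{AB} = σ_B ∘ σ_A`** (`σ_B(σ_A(Y_i)) = Σ_j A_{ij} Σ_l B_{jl} Y_l`).
[folklore] -/
theorem linSubst_mul (A B : Matrix (Fin d) (Fin d) k) :
    linSubst k (A * B) = (linSubst k B).comp (linSubst k A) := by
  refine MvPolynomial.algHom_ext fun i => ?_
  rw [AlgHom.comp_apply, linSubst_X, linSubst_X, map_sum]
  simp only [map_mul, MvPolynomial.algHom_C, MvPolynomial.algebraMap_eq, linSubst_X, Matrix.mul_apply,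
    Finset.mul_sum, map_sum, Finset.sum_mul]
  rw [Finset.sum_comm]
  exact Finset.sum_congr rfl fun j _ => Finset.sum_congr rfl fun l _ => by ring

/-- Functoriality on `k[Y, T]`: `σ_{AB} = σ_B ∘ σ_A`. [folklore] -/
theorem linSubstT_mul (A B : Matrix (Fin d) (Fin d) k) :
    linSubstT k (A * B) = (linSubstT k B).comp (linSubstT k A) := by
  refine MvPolynomial.algHom_ext fun o => ?_
  cases o with
  | none => simp
  | some i =>
    rw [AlgHom.comp_apply, linSubstT_X_some, linSubstT_X_some, map_sum]
    simp only [map_mul, MvPolynomial.algHom_C, MvPolynomial.algebraMap_eq, linSubstT_X_some,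
      Matrix.mul_apply, Finset.mul_sum, map_sum, Finset.sum_mul]
    rw [Finset.sum_comm]
    exact Finset.sum_congr rfl fun j _ => Finset.sum_congr rfl fun l _ => by ring

/-- For `A B = 1`, `σ_B ∘ σ_A = id`; in particular `σ_A` is injective when `A` has a right
inverse. [folklore] -/
theorem linSubstT_injective_of_mul_eq_one {A B : Matrix (Fin d) (Fin d) k} (hAB : A * B = 1) :
    Function.Injective (linSubstT k A) := by
  intro F G h
  have := congrArg (linSubstT k B) h
  rwa [← AlgHom.comp_apply, ← AlgHom.comp_apply, ← linSubstT_mul, hAB, linSubstT_one,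
    AlgHom.id_apply, AlgHom.id_apply] at this

/-- **Translations and linear substitutions: `τ_w ∘ σ_A = σ_A ∘ τ_{Aw}`** (`F(A(Y + Tw)) =
F(AY + T·Aw)`). [cite: CossartPiltant2008, proof of Prop. 4.2] -/
theorem translate_comp_linSubstT (A : Matrix (Fin d) (Fin d) k) (w : Fin d → k) :
    (translate k w).comp (linSubstT k A) = (linSubstT k A).comp (translate k (A.mulVec w)) := by
  refine MvPolynomial.algHom_ext fun o => ?_
  cases o with
  | none => simp
  | some i =>
    rw [AlgHom.comp_apply, AlgHom.comp_apply, linSubstT_X_some, translate_X_some, map_sum, map_add,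
      map_mul, linSubstT_X_some, MvPolynomial.algHom_C, MvPolynomial.algebraMap_eq, linSubstT_X_none,
      Matrix.mulVec, dotProduct, map_sum, Finset.sum_mul, ← Finset.sum_add_distrib]
    exact Finset.sum_congr rfl fun j _ => by
      rw [map_mul, MvPolynomial.algHom_C, MvPolynomial.algebraMap_eq, translate_X_some, map_mul]
      ring

/-- **`𝕎(σ_A S) = A⁻¹ 𝕎(S)`**: for an invertible matrix `A` (`A B = 1`), `w ∈ 𝕎(σ_A S)` iff
`Aw ∈ 𝕎(S)`. [cite: CossartPiltant2008, proof of Prop. 4.2] -/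
theorem mem_invarianceSpace_image_linSubst_iff {A B : Matrix (Fin d) (Fin d) k} (hAB : A * B = 1)
    (S : Set (MvPolynomial (Fin d) k)) (w : Fin d → k) :
    w ∈ invarianceSpace k (linSubst k A '' S) ↔ A.mulVec w ∈ invarianceSpace k S := by
  rw [mem_invarianceSpace_iff, mem_invarianceSpace_iff]
  have e1 : ∀ F : MvPolynomial (Fin d) k,
      rename some (linSubst k A F) = linSubstT k A (rename some F) :=
    fun F => (AlgHom.congr_fun (linSubstT_comp_rename k A) F).symm
  have e2 : ∀ G : MvPolynomial (Option (Fin d)) k,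
      translate k w (linSubstT k A G) = linSubstT k A (translate k (A.mulVec w) G) :=
    fun G => AlgHom.congr_fun (translate_comp_linSubstT k A w) G
  constructor
  · rintro h F hF
    have h1 := h _ ⟨F, hF, rfl⟩
    rw [e1, e2] at h1
    exact linSubstT_injective_of_mul_eq_one k hAB h1
  · rintro h _ ⟨F, hF, rfl⟩
    rw [e1, e2, h F hF]

/-- The same as an equality of subspaces: `𝕎(σ_A S)` is the preimage of `𝕎(S)` under `A`.
[cite: CossartPiltant2008, proof of Prop. 4.2] -/
theorem invarianceSpace_image_linSubst {A B : Matrix (Fin d) (Fin d) k} (hAB : A * B = 1)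
    (S : Set (MvPolynomial (Fin d) k)) :
    invarianceSpace k (linSubst k A '' S) = (invarianceSpace k S).comap (Matrix.toLin' A) := by
  ext w
  rw [Submodule.mem_comap, Matrix.toLin'_apply]
  exact mem_invarianceSpace_image_linSubst_iff k hAB S w

end LinSubst

section Field

variable (k : Type u) [Field k] {d : ℕ}

/-- For an invertible `A`, `dim 𝕎(σ_A S) = dim 𝕎(S)`. [cite: CossartPiltant2008, proof of Prop. 4.2] -/
theorem finrank_invarianceSpace_image_linSubst {A B : Matrix (Fin d) (Fin d) k} (hAB : A * B = 1)
    (hBA : B * A = 1) (S : Set (MvPolynomial (Fin d) k)) :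
    Module.finrank k (invarianceSpace k (linSubst k A '' S)) =
      Module.finrank k (invarianceSpace k S) := by
  rw [invarianceSpace_image_linSubst k hAB]
  -- `toLin' A` is a linear automorphism with inverse `toLin' B`
  let e : (Fin d → k) ≃ₗ[k] (Fin d → k) :=
    { Matrix.toLin' A with
      invFun := Matrix.toLin' B
      left_inv := fun v => by
        change Matrix.toLin' B (Matrix.toLin' A v) = v
        rw [← LinearMap.comp_apply, ← Matrix.toLin'_mul, hBA, Matrix.toLin'_one, LinearMap.id_apply]
      right_inv := fun v => by
        change Matrix.toLin' A (Matrix.toLin' B v) = v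
        rw [← LinearMap.comp_apply, ← Matrix.toLin'_mul, hAB, Matrix.toLin'_one, LinearMap.id_apply] }
  have he : (Matrix.toLin' A : (Fin d → k) →ₗ[k] (Fin d → k)) = e.toLinearMap := rfl
  rw [he, Submodule.comap_equiv_eq_map_symm, LinearEquiv.finrank_map_eq]

/-- **`τ` is invariant under invertible linear changes of the coordinates `Y`**: `τ(σ_A S) = τ(S)`
— so [CoP1]'s `τ(x)`, computed in `gr_𝔪(R) = k(x)[Y_1, Y_2, Y_3]` from a regular system of
parameters, does not depend on that choice. [cite: CossartPiltant2008, proof of Prop. 4.2] -/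
theorem hironakaTau_image_linSubst {A B : Matrix (Fin d) (Fin d) k} (hAB : A * B = 1)
    (hBA : B * A = 1) (S : Set (MvPolynomial (Fin d) k)) :
    hironakaTau k (linSubst k A '' S) = hironakaTau k S := by
  have h1 := hironakaTau_add_finrank_invarianceSpace k (linSubst k A '' S)
  have h2 := hironakaTau_add_finrank_invarianceSpace k S
  rw [finrank_invarianceSpace_image_linSubst k hAB hBA] at h1
  omega

end Field

end Literature.AlgebraicGeometry.Resolution

end
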